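import Summits.CriticalPhenomena.CardyFormulaZ2.Theorems.CardyBondTriangularBondTriangularCardyCrudeRun

/-!
# Route CardyBondTriangular · crux `BondTriangularCardy` (stmt-CriticalPhenomena-4664), line `birth`,
# stub `stub_yellowCrossingOfCrude`, II: runs of a far yellow chain inside the cofilled domain

Helper of the stub `stub_yellowCrossingOfCrude` (`Sig.stub_yellowCrossingOfCrude`, the
deterministic core of the upper half of Bollobás–Riordan's sandwich (19) for critical bond
percolation on `𝕋` in the Chayes–Lei hexagon packaging), second file: the run/class combinatorics
(Bollobás–Riordan, *Percolation*, CUP 2006, Ch. 7, Claims 19–20 p. 192, made deterministic).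

Setting. A 4-marked discrete domain `G ⊆ δ𝕋` whose discrete arcs `Aᵢ(G)` are within `η` of the
arcs `Aᵢ` of the conformal rectangle `R`, which is COFILLED at scale `κ` away from the corners
(every hexagon with centre within `2δ` of `Ω`, `ρ`-far from the corners and `κ`-far from
`A₀ ∪ A₂`, is a site of `G`), with `4δ ≤ κ`, `4(κ + η + δ) ≤ ρ`, `A₀` and `A₂` more than
`4(κ + η + δ)` apart, and points of `A₀ ∪ A₂` at distance `≥ ρ/2` from the corners more than
`4(κ + η + δ)` from `A₁ ∪ A₃`.

* `stretch_eq_of_near_arc`: a boundary dart of `G` in the `i`-th stretch whose head is `ρ`-far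
  from the corners and `κ`-close to `A_c`, `c ∈ {0, 2}`, has `i = c` (its tail is on `Aᵢ(G)`,
  `η`-close to `Aᵢ`; the separation hypotheses exclude `i ≠ c`).
* `crossing_of_run`: a yellow walk of hexagons of `G` entered from an outside hexagon of class
  `A₀` and left to an outside hexagon of class `A₂` is a yellow crossing of `G` from its stretch
  `0` to its stretch `2` in the format of `TriMarkedDomain.clSepEvent`.
* `crossing_of_farChain`: a yellow walk of non-blue hexagons with centres within `2δ` of `Ω` and
  `ρ`-far from the corners, from an outside hexagon of class `A₀` to an outside hexagon of class
  `A₂`, contains such a crossing: outside hexagons have a well defined class (cofill), adjacent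
  outside hexagons the same class, so the class changes across some maximal inside run (strong
  induction on the length, first exit from `G`).

References: B. Bollobás, O. Riordan, *Percolation*, CUP 2006, Ch. 7, Claims 19–20 p. 192;
L. Chayes, H. K. Lei, Rev. Math. Phys. 19 (2007) §2.1–2.3.
-/

noncomputable section

namespace Summit.CriticalPhenomena.CardyFormulaZ2.Theorems.BondTriangularCardyLine

open Set Filter Topology Metric
open Literature.Probability.Percolation Literature.Probability.RandomPlanarGeometry
open Literature.Probability.RandomPlanarGeometry.MarkedDomain
open Literature.Probability.LatticeModels

/-! ### Two walk lemmas -/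

/-- **First exit of a walk from a set of vertices, with supports**: a walk starting at a vertex
satisfying `P` either has all its vertices satisfying `P`, or splits as a walk inside `P`, an
edge to a vertex violating `P`, and a strictly shorter remainder, both pieces supported on the
support of the walk (variant of `walk_first_exit`). -/
theorem walk_first_exit_support {V : Type*} (H : SimpleGraph V) (P : V → Prop) :
    ∀ {y₀ v : V} (W₀ : H.Walk y₀ v), P y₀ →
      (∀ z ∈ W₀.support, P z) ∨
        ∃ (y₁ y₂ : V) (W₁ : H.Walk y₀ y₁) (_ : H.Adj y₁ y₂) (W₂ : H.Walk y₂ v),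
          (∀ z ∈ W₁.support, P z) ∧ ¬ P y₂ ∧ W₂.length < W₀.length ∧
          (∀ z ∈ W₁.support, z ∈ W₀.support) ∧ (∀ z ∈ W₂.support, z ∈ W₀.support) := by
  -- adapted from `walk_first_exit` (…CardyCrudeRun.lean)
  intro y₀ v W₀
  induction W₀ with
  | nil =>
    intro hy₀
    exact Or.inl fun z hz => by
      rw [SimpleGraph.Walk.support_nil, List.mem_singleton] at hz; rw [hz]; exact hy₀
  | @cons a₀ a₁ _ had W₀' ih₀ =>
    intro hy₀
    by_cases ha₁ : P a₁
    · rcases ih₀ ha₁ with hall | ⟨y₁, y₂, W₁, h12, W₂, hW₁, hy₂, hlt, hs₁, hs₂⟩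
      · refine Or.inl fun z hz => ?_
        rw [SimpleGraph.Walk.support_cons, List.mem_cons] at hz
        rcases hz with rfl | hz
        · exact hy₀
        · exact hall z hz
      · refine Or.inr ⟨y₁, y₂, SimpleGraph.Walk.cons had W₁, h12, W₂, ?_, hy₂, ?_, ?_, ?_⟩
        · intro z hz
          rw [SimpleGraph.Walk.support_cons, List.mem_cons] at hz
          rcases hz with rfl | hz
          · exact hy₀
          · exact hW₁ z hz
        · simp only [SimpleGraph.Walk.length_cons]; omega
        · intro z hz
          rw [SimpleGraph.Walk.support_cons, List.mem_cons] at hz ⊢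
          rcases hz with h | h
          · exact Or.inl h
          · exact Or.inr (hs₁ z h)
        · intro z hz
          rw [SimpleGraph.Walk.support_cons, List.mem_cons]
          exact Or.inr (hs₂ z hz)
    · refine Or.inr ⟨a₀, a₁, SimpleGraph.Walk.nil, had, W₀', ?_, ha₁, ?_, ?_, ?_⟩
      · intro z hz
        rw [SimpleGraph.Walk.support_nil, List.mem_singleton] at hz; rw [hz]; exact hy₀
      · simp only [SimpleGraph.Walk.length_cons]; omega
      · intro z hz
        rw [SimpleGraph.Walk.support_nil, List.mem_singleton] at hz
        rw [hz, SimpleGraph.Walk.support_cons]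
        exact List.mem_cons_self
      · intro z hz
        rw [SimpleGraph.Walk.support_cons]
        exact List.mem_cons_of_mem _ hz

/-- The darts of a walk mapped to a supergraph are adjacencies of the subgraph. -/
theorem darts_adj_of_mapLe {V : Type*} {H G : SimpleGraph V} (hle : H ≤ G) :
    ∀ {u v : V} (p : H.Walk u v), ∀ d ∈ (p.mapLe hle).darts, H.Adj d.fst d.snd := by
  intro u v p
  induction p with
  | nil => intro d hd; exact absurd hd List.not_mem_nil
  | cons h p' ih =>
    intro d hd
    rcases List.mem_cons.1 hd with rfl | hd'
    · exact h
    · exact ih d hd'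

/-! ### The stretch of a boundary dart next to an outside hexagon of class `A₀` / `A₂` -/

/-- A boundary dart of a 4-marked domain lies in the stretch of its position. -/
theorem mem_stretch_stretchIdx_dpos (G : TriMarkedDomain 4) {d : Site 2 × Site 2} (hd : d ∈ triBdryDarts G.verts) :
    d ∈ G.stretch (G.stretchIdx (G.dpos d)) := by
  have := G.iter_mem_stretch (G.dpos d)
  rwa [G.iter_dpos hd] at this

/-- **The stretch index of a boundary dart next to an outside hexagon of class `A_c`.** Under
the arc-closeness and separation hypotheses of `Sig.stub_yellowCrossingOfCrude`, a dart of the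
`i`-th stretch of `G` whose head is `ρ`-far from the corners and within `< κ` of `A_c`,
`c ∈ {0, 2}`, has `i = c`: its tail lies on `Aᵢ(G)`, within `η` of `Aᵢ`, so a point of `Aᵢ` is
within `κ + η + 2δ` of a point of `A_c` which is `ρ/2`-far from the corners — excluded for
`i ≠ c` by the separation of `A₀` from `A₂` and of the far parts of `A₀ ∪ A₂` from `A₁ ∪ A₃`. -/
theorem stretch_eq_of_near_arc (R : ConformalRectangle) {G : TriMarkedDomain 4} {δ ρ κ η : ℝ} (hδ : 0 < δ)
    (harcs : ∀ i : Fin 4, ∀ u ∈ G.arc i, infDist (triMeshPoint δ u) (R.arc i) ≤ η)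
    (hκ : 4 * δ ≤ κ) (hρ : 4 * (κ + η + δ) ≤ ρ)
    (h02 : ∀ a ∈ R.arc 0, ∀ b ∈ R.arc 2, 4 * (κ + η + δ) < dist a b)
    (hsep : ∀ a ∈ R.arc 0 ∪ R.arc 2, (∀ j : Fin 4, ρ / 2 ≤ dist a (R.pt j)) →
      ∀ b ∈ R.arc 1 ∪ R.arc 3, 4 * (κ + η + δ) < dist a b)
    {i c : Fin 4} (hc : c = 0 ∨ c = 2) {d : Site 2 × Site 2} (hd : d ∈ G.stretch i)
    (hfar : ∀ j : Fin 4, ρ ≤ dist (triMeshPoint δ d.2) (R.pt j))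
    (hnear : infDist (triMeshPoint δ d.2) (R.arc c) < κ) : i = c := by
  have hη : 0 ≤ η := infDist_nonneg.trans (harcs 0 _ (G.markSite_mem_arc 0))
  have hbd : d ∈ triBdryDarts G.verts := G.stretch_subset_triBdryDarts i hd
  obtain ⟨-, -, hadj⟩ := mem_triBdryDarts.1 hbd
  have hdd : dist (triMeshPoint δ d.1) (triMeshPoint δ d.2) = δ := by
    rw [dist_triMeshPoint_of_adj hadj, abs_of_pos hδ]
  have hd1 : d.1 ∈ G.arc i := Finset.mem_image_of_mem _ hd
  have hcne : (R.arc c).Nonempty := ⟨_, R.pt_mem_arc_self c⟩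
  have hine : (R.arc i).Nonempty := ⟨_, R.pt_mem_arc_self i⟩
  obtain ⟨b, hb, hdb⟩ := (infDist_lt_iff hine).1 (lt_of_le_of_lt (harcs i d.1 hd1) (lt_add_of_pos_right η hδ))
  obtain ⟨a, ha, hda⟩ := (infDist_lt_iff hcne).1 hnear
  have hab : dist a b < κ + η + 2 * δ := by
    have h1 := dist_triangle4 a (triMeshPoint δ d.2) (triMeshPoint δ d.1) b
    have h2 := dist_comm a (triMeshPoint δ d.2)
    have h3 := dist_comm (triMeshPoint δ d.2) (triMeshPoint δ d.1)
    linarith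
  have hafar : ∀ j : Fin 4, ρ / 2 ≤ dist a (R.pt j) := by
    intro j
    have h1 := dist_triangle (triMeshPoint δ d.2) a (R.pt j)
    have h2 := hfar j
    linarith
  have ha02 : a ∈ R.arc 0 ∪ R.arc 2 := by
    rcases hc with rfl | rfl
    exacts [Or.inl ha, Or.inr ha]
  by_contra hne
  have hlt : 4 * (κ + η + δ) < dist a b := by
    have hi : i = 0 ∨ i = 1 ∨ i = 2 ∨ i = 3 := by fin_cases i <;> decide
    rcases hc with rfl | rfl <;> rcases hi with rfl | rfl | rfl | rfl
    · exact absurd rfl hne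
    · exact hsep a ha02 hafar b (Or.inl hb)
    · exact h02 a ha b hb
    · exact hsep a ha02 hafar b (Or.inr hb)
    · rw [dist_comm]; exact h02 b hb a ha
    · exact hsep a ha02 hafar b (Or.inl hb)
    · exact absurd rfl hne
    · exact hsep a ha02 hafar b (Or.inr hb)
  linarith

/-! ### A run of the chain inside `G` between outside hexagons of classes `A₀` and `A₂` is a crossing -/

/-- **An inside run between the two classes is a yellow crossing of `G` from stretch `0` to
stretch `2`.** Let `a ∉ G` be `ρ`-far from the corners and within `< κ` of `A₀`, yellow-adjacent
to `a'`; let `W` be a yellow walk from `a'` to `y₁` all of whose hexagons are in `G` and not pure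
blue; let `y₁` be yellow-adjacent to `y₂ ∉ G`, `ρ`-far from the corners and within `< κ` of `A₂`.
Then `(a', a) ∈ stretch 0`, `(y₁, y₂) ∈ stretch 2` (`stretch_eq_of_near_arc`), the hexagons `a'`,
`y₁` show yellow towards `a`, `y₂` (the yellow half-edges of the two adjacencies), and `W` is the
crossing. -/
theorem crossing_of_run (R : ConformalRectangle) {G : TriMarkedDomain 4} {δ ρ κ η : ℝ} (hδ : 0 < δ)
    (harcs : ∀ i : Fin 4, ∀ u ∈ G.arc i, infDist (triMeshPoint δ u) (R.arc i) ≤ η)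
    (hκ : 4 * δ ≤ κ) (hρ : 4 * (κ + η + δ) ≤ ρ)
    (h02 : ∀ a ∈ R.arc 0, ∀ b ∈ R.arc 2, 4 * (κ + η + δ) < dist a b)
    (hsep : ∀ a ∈ R.arc 0 ∪ R.arc 2, (∀ j : Fin 4, ρ / 2 ≤ dist a (R.pt j)) →
      ∀ b ∈ R.arc 1 ∪ R.arc 3, 4 * (κ + η + δ) < dist a b)
    {σ : CLHexConfig} {a a' y₁ y₂ : Site 2} (haG : a ∉ G.verts)
    (ha0 : infDist (triMeshPoint δ a) (R.arc 0) < κ) (hafar : ∀ j : Fin 4, ρ ≤ dist (triMeshPoint δ a) (R.pt j))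
    (h : (clYellowGraph σ).Adj a a') (W : (clYellowGraph σ).Walk a' y₁)
    (hW : ∀ z ∈ W.support, z ∈ G.verts ∧ σ z ≠ CLHexState.B)
    (h12 : (clYellowGraph σ).Adj y₁ y₂) (hy₂G : y₂ ∉ G.verts)
    (hy2 : infDist (triMeshPoint δ y₂) (R.arc 2) < κ) (hy₂far : ∀ j : Fin 4, ρ ≤ dist (triMeshPoint δ y₂) (R.pt j)) :
    ∃ (du dv : Site 2 × Site 2) (P : triGraph.Walk du.1 dv.1),
      du ∈ G.stretch 0 ∧ dv ∈ G.stretch 2 ∧ YellowTowards σ du ∧ YellowTowards σ dv ∧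
      (∀ x ∈ P.support, x ∈ G.verts ∧ σ x ≠ CLHexState.B) ∧
      ∀ d ∈ P.darts, (clYellowGraph σ).Adj d.fst d.snd := by
  have ha'G : a' ∈ G.verts := (hW a' W.start_mem_support).1
  have hy₁G : y₁ ∈ G.verts := (hW y₁ W.end_mem_support).1
  have hdu : (a', a) ∈ triBdryDarts G.verts := mem_triBdryDarts.2 ⟨ha'G, haG, clYellowGraph_le σ h.symm⟩
  have hdv : (y₁, y₂) ∈ triBdryDarts G.verts := mem_triBdryDarts.2 ⟨hy₁G, hy₂G, clYellowGraph_le σ h12⟩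
  have hsu := mem_stretch_stretchIdx_dpos G hdu
  have hsv := mem_stretch_stretchIdx_dpos G hdv
  have hi0 : G.stretchIdx (G.dpos (a', a)) = 0 :=
    stretch_eq_of_near_arc R hδ harcs hκ hρ h02 hsep (Or.inl rfl) hsu hafar ha0
  have hi2 : G.stretchIdx (G.dpos (y₁, y₂)) = 2 :=
    stretch_eq_of_near_arc R hδ harcs hκ hρ h02 hsep (Or.inr rfl) hsv hy₂far hy2
  rw [hi0] at hsu
  rw [hi2] at hsv
  obtain ⟨-, F, hF1, hF2, hyF, -⟩ := (clYellowGraph_adj_iff σ a' a).1 h.symm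
  obtain ⟨-, F', hF1', hF2', hyF', -⟩ := (clYellowGraph_adj_iff σ y₁ y₂).1 h12
  refine ⟨(a', a), (y₁, y₂), W.mapLe (clYellowGraph_le σ), hsu, hsv, ⟨F, hF1, hF2, hyF⟩, ⟨F', hF1', hF2', hyF'⟩, ?_,
    darts_adj_of_mapLe (clYellowGraph_le σ) W⟩
  intro x hx
  rw [SimpleGraph.Walk.support_mapLe_eq_support] at hx
  exact hW x hx

/-! ### A far yellow chain from class `A₀` to class `A₂` contains a crossing -/

/-- **A far yellow chain from an outside hexagon of class `A₀` to an outside hexagon of class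
`A₂` contains a yellow crossing of the cofilled domain from stretch `0` to stretch `2`.** Let `Y`
be a walk in the yellow graph of `σ`, all of whose hexagons are not pure blue, have centres within
`2δ` of `Ω` and are `ρ`-far from the corners, from `a ∉ G` within `< κ` of `A₀` to `b ∉ G` within
`< κ` of `A₂`. By cofill an outside hexagon of `Y` is within `< κ` of `A₀` or of `A₂`, never both
and never the other class for a neighbour (`A₀`, `A₂` are `> 2κ + δ` apart); scanning `Y` (strong
induction on the length): while outside, the class stays `A₀`; once inside, the first exit from
`G` leads to an outside hexagon of class `A₀` — restart on the shorter remainder — or of class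
`A₂` — the inside run is the crossing (`crossing_of_run`). -/
theorem crossing_of_farChain (R : ConformalRectangle) {G : TriMarkedDomain 4} {δ ρ κ η : ℝ} (hδ : 0 < δ)
    (harcs : ∀ i : Fin 4, ∀ u ∈ G.arc i, infDist (triMeshPoint δ u) (R.arc i) ≤ η)
    (hco : ∀ x : Site 2, infDist (triMeshPoint δ x) R.carrier ≤ 2 * δ →
      (∀ j : Fin 4, ρ ≤ dist (triMeshPoint δ x) (R.pt j)) →
      κ ≤ infDist (triMeshPoint δ x) (R.arc 0) → κ ≤ infDist (triMeshPoint δ x) (R.arc 2) → x ∈ G.verts)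
    (hκ : 4 * δ ≤ κ) (hρ : 4 * (κ + η + δ) ≤ ρ)
    (h02 : ∀ a ∈ R.arc 0, ∀ b ∈ R.arc 2, 4 * (κ + η + δ) < dist a b)
    (hsep : ∀ a ∈ R.arc 0 ∪ R.arc 2, (∀ j : Fin 4, ρ / 2 ≤ dist a (R.pt j)) →
      ∀ b ∈ R.arc 1 ∪ R.arc 3, 4 * (κ + η + δ) < dist a b)
    {σ : CLHexConfig} :
    ∀ (n : ℕ) {a b : Site 2} (Y : (clYellowGraph σ).Walk a b), Y.length ≤ n →
      (∀ z ∈ Y.support, σ z ≠ CLHexState.B ∧ infDist (triMeshPoint δ z) R.carrier ≤ 2 * δ ∧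
        ∀ j : Fin 4, ρ ≤ dist (triMeshPoint δ z) (R.pt j)) →
      a ∉ G.verts → infDist (triMeshPoint δ a) (R.arc 0) < κ →
      b ∉ G.verts → infDist (triMeshPoint δ b) (R.arc 2) < κ →
      ∃ (du dv : Site 2 × Site 2) (P : triGraph.Walk du.1 dv.1),
        du ∈ G.stretch 0 ∧ dv ∈ G.stretch 2 ∧ YellowTowards σ du ∧ YellowTowards σ dv ∧
        (∀ x ∈ P.support, x ∈ G.verts ∧ σ x ≠ CLHexState.B) ∧
        ∀ d ∈ P.darts, (clYellowGraph σ).Adj d.fst d.snd := by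
  have hA0ne : (R.arc 0).Nonempty := ⟨_, R.pt_mem_arc_self 0⟩
  have hA2ne : (R.arc 2).Nonempty := ⟨_, R.pt_mem_arc_self 2⟩
  have hη : 0 ≤ η := infDist_nonneg.trans (harcs 0 _ (G.markSite_mem_arc 0))
  -- no two `δ`-close hexagons are of classes `A₀` and `A₂`
  have hC2 : ∀ o o' : Site 2, dist (triMeshPoint δ o) (triMeshPoint δ o') ≤ δ →
      infDist (triMeshPoint δ o) (R.arc 0) < κ → infDist (triMeshPoint δ o') (R.arc 2) < κ → False := by
    intro o o' hoo' h0 h2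
    obtain ⟨a, ha, hda⟩ := (infDist_lt_iff hA0ne).1 h0
    obtain ⟨b, hb, hdb⟩ := (infDist_lt_iff hA2ne).1 h2
    have h1 := h02 a ha b hb
    have h3 := dist_triangle4 a (triMeshPoint δ o) (triMeshPoint δ o') b
    have h4 := dist_comm a (triMeshPoint δ o)
    linarith
  -- the class of an outside hexagon of the chain
  have hC1 : ∀ o : Site 2, infDist (triMeshPoint δ o) R.carrier ≤ 2 * δ →
      (∀ j : Fin 4, ρ ≤ dist (triMeshPoint δ o) (R.pt j)) → o ∉ G.verts →
      infDist (triMeshPoint δ o) (R.arc 0) < κ ∨ infDist (triMeshPoint δ o) (R.arc 2) < κ := by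
    intro o hΩ hfar hoG
    by_contra hnot
    rw [not_or, not_lt, not_lt] at hnot
    exact hoG (hco o hΩ hfar hnot.1 hnot.2)
  intro n
  induction n with
  | zero =>
    intro a b Y hlen _ _ ha0 _ hb2
    have hab : a = b := SimpleGraph.Walk.eq_of_length_eq_zero (Nat.le_zero.1 hlen)
    subst hab
    exact (hC2 a a (by rw [dist_self]; exact hδ.le) ha0 hb2).elim
  | succ n ih =>
    intro a b Y hlen hgood haG ha0 hbG hb2
    by_cases hshort : Y.length ≤ n
    · exact ih Y hshort hgood haG ha0 hbG hb2
    cases Y with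
    | nil => exact absurd (Nat.zero_le n) (by simp at hshort)
    | @cons _ a' _ h Y' =>
      have hlen' : Y'.length ≤ n := by
        simp only [SimpleGraph.Walk.length_cons] at hlen; omega
      have hsub : ∀ z ∈ Y'.support, z ∈ (SimpleGraph.Walk.cons h Y').support := fun z hz => by
        rw [SimpleGraph.Walk.support_cons]; exact List.mem_cons_of_mem _ hz
      have hgood' : ∀ z ∈ Y'.support, σ z ≠ CLHexState.B ∧ infDist (triMeshPoint δ z) R.carrier ≤ 2 * δ ∧
          ∀ j : Fin 4, ρ ≤ dist (triMeshPoint δ z) (R.pt j) := fun z hz => hgood z (hsub z hz)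
      have haa' : dist (triMeshPoint δ a) (triMeshPoint δ a') ≤ δ := by
        rw [dist_triMeshPoint_of_adj (clYellowGraph_le σ h), abs_of_pos hδ]
      by_cases ha'G : a' ∈ G.verts
      · -- `a'` inside: scan `Y'` for its first exit from `G`
        rcases walk_first_exit_support (clYellowGraph σ) (· ∈ G.verts) Y' ha'G with
          hall | ⟨y₁, y₂, W₁, h12, W₂, hW₁, hy₂, hlt, hs₁, hs₂⟩
        · exact (hbG (hall b Y'.end_mem_support)).elim
        · have hg₂ := hgood' y₂ (hs₂ y₂ W₂.start_mem_support)
          rcases hC1 y₂ hg₂.2.1 hg₂.2.2 hy₂ with hy0 | hy2'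
          · -- the exit hexagon is of class `A₀` again: restart from it
            exact ih W₂ (by omega) (fun z hz => hgood' z (hs₂ z hz)) hy₂ hy0 hbG hb2
          · -- the exit hexagon is of class `A₂`: the inside run is the crossing
            exact crossing_of_run R hδ harcs hκ hρ h02 hsep haG ha0
              (hgood a (SimpleGraph.Walk.start_mem_support _)).2.2 h W₁
              (fun z hz => ⟨hW₁ z hz, (hgood' z (hs₁ z hz)).1⟩) h12 hy₂ hy2' hg₂.2.2
      · -- `a'` outside: it is of class `A₀` as well
        have hg' := hgood' a' Y'.start_mem_support
        rcases hC1 a' hg'.2.1 hg'.2.2 ha'G with h0 | h2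
        · exact ih Y' hlen' hgood' ha'G h0 hbG hb2
        · exact (hC2 a a' haa' ha0 h2).elim

/-! ### Registered anchor -/

/-- **Registered anchor of this file** (`yellowOfCrude_farCrossing`, helper of the stub
`stub_yellowCrossingOfCrude`): a far yellow chain from class `A₀` to class `A₂` contains a yellow
crossing of the cofilled domain from stretch `0` to stretch `2`, arrow form of
`crossing_of_farChain`. -/
theorem yellowOfCrude_farCrossing : ∀ (R : Literature.Probability.RandomPlanarGeometry.ConformalRectangle) (G : Literature.Probability.Percolation.TriMarkedDomain 4) (δ ρ κ η : ℝ) (σ : Literature.Probability.Percolation.CLHexConfig), 0 < δ → (∀ i : Fin 4, ∀ u ∈ G.arc i, Metric.infDist (Literature.Probability.LatticeModels.triMeshPoint δ u) (R.arc i) ≤ η) → (∀ x : Literature.Probability.LatticeModels.Site 2, Metric.infDist (Literature.Probability.LatticeModels.triMeshPoint δ x) R.carrier ≤ 2 * δ → (∀ j : Fin 4, ρ ≤ dist (Literature.Probability.LatticeModels.triMeshPoint δ x) (R.pt j)) → κ ≤ Metric.infDist (Literature.Probability.LatticeModels.triMeshPoint δ x) (R.arc 0) → κ ≤ Metric.infDist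 (Literature.Probability.LatticeModels.triMeshPoint δ x) (R.arc 2) → x ∈ G.verts) → 4 * δ ≤ κ → 4 * (κ + η + δ) ≤ ρ → (∀ a ∈ R.arc 0, ∀ b ∈ R.arc 2, 4 * (κ + η + δ) < dist a b) → (∀ a ∈ R.arc 0 ∪ R.arc 2, (∀ j : Fin 4, ρ / 2 ≤ dist a (R.pt j)) → ∀ b ∈ R.arc 1 ∪ R.arc 3, 4 * (κ + η + δ) < dist a b) → ∀ (n : ℕ) (a b : Literature.Probability.LatticeModels.Site 2) (Y : (Literature.Probability.Percolation.clYellowGraph σ).Walk a b), Y.length ≤ n → (∀ z ∈ Y.support, σ z ≠ Literature.Probability.Percolation.CLHexState.B ∧ Metric.infDist (Literature.Probability.LatticeModels.triMeshPoint δ z) R.carrier ≤ 2 * δ ∧ ∀ j : Fin 4, ρ ≤ dist (Literature.Probability.LatticeModels.triMeshPoint δ z) (R.pt j)) → a ∉ G.verts → Metric.infDist (Literature.Probability.LatticeModels.triMeshPoint δ a) (R.arc 0) < κ → b ∉ G.verts → Metric.infDist (Literature.Probability.LatticeModels.triMeshPoint δ b) (R.arc 2) < κ → ∃ (du dv : Literature.Probability.LatticeModels.Site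 2 × Literature.Probability.LatticeModels.Site 2) (P : Literature.Probability.LatticeModels.triGraph.Walk du.1 dv.1), du ∈ G.stretch 0 ∧ dv ∈ G.stretch 2 ∧ Literature.Probability.Percolation.YellowTowards σ du ∧ Literature.Probability.Percolation.YellowTowards σ dv ∧ (∀ x ∈ P.support, x ∈ G.verts ∧ σ x ≠ Literature.Probability.Percolation.CLHexState.B) ∧ ∀ d ∈ P.darts, (Literature.Probability.Percolation.clYellowGraph σ).Adj d.fst d.snd :=
  fun R _ _ _ _ _ _ hδ harcs hco hκ hρ h02 hsep n _ _ Y hlen hgood haG ha0 hbG hb2 =>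
    crossing_of_farChain R hδ harcs hco hκ hρ h02 hsep n Y hlen hgood haG ha0 hbG hb2

end Summit.CriticalPhenomena.CardyFormulaZ2.Theorems.BondTriangularCardyLine

end
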